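import Summits.CriticalPhenomena.Ising3DConformalLimit.Theorems.PlantedPinningGaussianPinningSaturationDefs
import Summits.CriticalPhenomena.Ising3DConformalLimit.Theses.IsingEuclidUpgrade

/-!
# Line `birth` for crux `GaussianPinningSaturation` (stmt-CriticalPhenomena-8452): structure of the split

Lead seat c1 (`prover-line-stmt-CriticalPhenomena-8452-c1-0`), route `PlantedPinning`, sub-problem
`Ising3DConformalLimit`. Finite-`L`, hypothesis-free bookkeeping around the linear-benchmark split
`e = e^{lin} − e^{gap}` of `Theorems/PlantedPinningGaussianPinningSaturationDefs.lean`: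

* `regressionGap_nonneg`, `gapVar_nonneg`, `gapEff_nonneg` — the nonlinear regression gap and its
  efficiency are nonnegative (`w(τ)/Z > 0`, squares, `k ≤ n`);
* `plantedEff_le_linEff` — given stub A (`VarianceSplit`), `e ≤ e^{lin}`;
* the split is LOSSLESS: given A, the crux forces the conclusion of stub B under the crux hypotheses
  (`linEff_saturates_of_crux`), and given A and the Gaussian ceiling `e^{lin} ≤ 1` it forces stub C
  (`gaussianLinearisesRegression_of_crux`) — so B-conclusion and C are necessary cuts, not an arbitrary
  sufficient pair;
* the VACUOUS payer: item 0636 `IsingEuclidUpgradeR4NonGaussian` (every non-degenerate pointwise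
  scaling limit of `criticalCorr 3` has `U₄ ≢ 0`) contradicts the crux hypotheses, hence gives stub C
  and the crux outright (`gaussianLinearisesRegression_of_R4NonGaussian`,
  `gaussianPinningSaturation_of_R4NonGaussian` = registered bookkeeping stub `stub_cruxOfR4NonGaussian`).

No definitions, no named facts, no `sorry`.
-/

noncomputable section

namespace Summit.CriticalPhenomena.Ising3DConformalLimit.PlantedPinningGaussianPinningSaturation

open scoped BigOperators Classical
open Finset MeasureTheory
open Literature.Probability.LatticeModels
open Summit.CriticalPhenomena.Ising3DConformalLimit.Theses.PlantedPinning
open Summit.CriticalPhenomena.Ising3DConformalLimit.Theses.IsingEuclidUpgrade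

/-! ### Nonnegativity of the regression gap -/

/-- The planted law `w(τ)/Z` of the pin values is nonnegative. -/
theorem plusProb_nonneg (L : ℕ) (τ : ↥(box 3 L) → ℤˣ) : 0 ≤ plusProb L τ :=
  div_nonneg (isingWeight_pos (zdGraph 3) (box 3 L) (criticalBeta 3) 0 .plus τ).le
    (isingPartitionFunction_pos (zdGraph 3) (box 3 L) (criticalBeta 3) 0 .plus).le

/-- The nonlinear regression gap `N_L(P) = E⁺[(E[M|σ_P] − Lin_P)²]` is nonnegative. -/
theorem regressionGap_nonneg (L : ℕ) (P : Finset (Site 3)) : 0 ≤ regressionGap L P :=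
  Finset.sum_nonneg fun τ _ => mul_nonneg (plusProb_nonneg L τ) (sq_nonneg _)

/-- The averaged regression gap is nonnegative. -/
theorem gapVar_nonneg (L k : ℕ) : 0 ≤ gapVar L k :=
  div_nonneg (Finset.sum_nonneg fun P _ => regressionGap_nonneg L P) (Nat.cast_nonneg _)

/-- The normalisation `e = k·v/((n+1)(n−k+1))` is monotone in `v` for `k ≤ n`. -/
theorem effOf_mono (L k : ℕ) (hk : k ≤ (box 3 L).card) {v v' : ℝ} (h : v ≤ v') :
    effOf L k v ≤ effOf L k v' := by
  unfold effOf
  have hnk : (0 : ℝ) < ((box 3 L).card : ℝ) - k + 1 := by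
    have : (k : ℝ) ≤ (box 3 L).card := by exact_mod_cast hk
    linarith
  have hD : (0 : ℝ) < (((box 3 L).card : ℝ) + 1) * (((box 3 L).card : ℝ) - k + 1) :=
    mul_pos (by positivity) hnk
  exact div_le_div_of_nonneg_right (mul_le_mul_of_nonneg_left h (Nat.cast_nonneg k)) hD.le

/-- The normalisation of a nonnegative quantity is nonnegative for `k ≤ n`. -/
theorem effOf_nonneg (L k : ℕ) (hk : k ≤ (box 3 L).card) {v : ℝ} (h : 0 ≤ v) :
    0 ≤ effOf L k v := by
  have h0 : effOf L k 0 = 0 := by unfold effOf; simp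
  rw [← h0]
  exact effOf_mono L k hk h

/-- The gap efficiency `e^{gap}_L(k)` is nonnegative for `k ≤ |Λ_L|`. -/
theorem gapEff_nonneg (L k : ℕ) (hk : k ≤ (box 3 L).card) : 0 ≤ gapEff L k :=
  effOf_nonneg L k hk (gapVar_nonneg L k)

/-- Given the variance split (stub A), `e_L(k) ≤ e^{lin}_L(k)` for `k ≤ |Λ_L|`. -/
theorem plantedEff_le_linEff (hA : VarianceSplit) (L k : ℕ) (hk : k ≤ (box 3 L).card) :
    plantedEff L k ≤ linEff L k := by
  rw [plantedEff_eq_linEff_sub_gapEff hA]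
  linarith [gapEff_nonneg L k hk]

/-- The pin number `⌈p·n⌉` does not exceed `n` for `p ≤ 1`. -/
theorem ceil_mul_card_le {p : ℝ} (hp : p ≤ 1) (L : ℕ) :
    ⌈p * ((box 3 L).card : ℝ)⌉₊ ≤ (box 3 L).card := by
  refine Nat.ceil_le.2 ?_
  have h : p * ((box 3 L).card : ℝ) ≤ 1 * ((box 3 L).card : ℝ) :=
    mul_le_mul_of_nonneg_right hp (Nat.cast_nonneg _)
  simpa using h

/-! ### The split is lossless -/

/-- **Necessity of stub B's conclusion.** Given stub A, the crux forces saturation of the LINEAR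
efficiency under the crux hypotheses (`e ≤ e^{lin}`). -/
theorem linEff_saturates_of_crux (hA : VarianceSplit) (hcrux : GaussianPinningSaturation) :
    ∀ (ρ : ℝ → ℝ) (Δ : ℝ) (S : CorrFamily 3), (∀ δ ∈ Set.Ioc (0:ℝ) 1, 0 < ρ δ) → 0 < Δ →
      HasPointwiseScalingLimit (criticalCorr 3) ρ S → IsNondegenerateTwoPoint S →
      IsMoebiusCovariant Δ S → ¬ HasNontrivialU4 S →
      ∀ ε : ℝ, 0 < ε → ∃ p₀ : ℝ, 0 < p₀ ∧ ∀ p : ℝ, 0 < p → p < p₀ → ∃ L₀ : ℕ, ∀ L ≥ L₀,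
        1 - ε ≤ linEff L ⌈p * ((box 3 L).card : ℝ)⌉₊ := by
  rw [gaussianPinningSaturation_iff] at hcrux
  intro ρ Δ S hρ hΔ hlim hnd hmob hU4 ε hε
  obtain ⟨p₀, hp₀, h⟩ := hcrux ρ Δ S hρ hΔ hlim hnd hmob hU4 ε hε
  refine ⟨min p₀ 1, lt_min hp₀ one_pos, fun p hp hpp => ?_⟩
  obtain ⟨L₀, hL₀⟩ := h p hp (lt_of_lt_of_le hpp (min_le_left _ _))
  refine ⟨L₀, fun L hL => ?_⟩
  have hk := ceil_mul_card_le (le_of_lt (lt_of_lt_of_le hpp (min_le_right _ _))) L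
  exact le_trans (hL₀ L hL) (plantedEff_le_linEff hA L _ hk)

/-- **Necessity of stub C.** Given stub A and the Gaussian ceiling `e^{lin} ≤ 1` for `k ≤ n`,
the crux forces the gap efficiency to vanish: `e^{gap} = e^{lin} − e ≤ 1 − (1 − ε) = ε`. -/
theorem gaussianLinearisesRegression_of_crux (hA : VarianceSplit)
    (hceil : ∀ (L k : ℕ), k ≤ (box 3 L).card → linEff L k ≤ 1)
    (hcrux : GaussianPinningSaturation) : GaussianLinearisesRegression := by
  rw [gaussianPinningSaturation_iff] at hcrux
  intro ρ Δ S hρ hΔ hlim hnd hmob hU4 ε hε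
  obtain ⟨p₀, hp₀, h⟩ := hcrux ρ Δ S hρ hΔ hlim hnd hmob hU4 ε hε
  refine ⟨min p₀ 1, lt_min hp₀ one_pos, fun p hp hpp => ?_⟩
  obtain ⟨L₀, hL₀⟩ := h p hp (lt_of_lt_of_le hpp (min_le_left _ _))
  refine ⟨L₀, fun L hL => ?_⟩
  have hk := ceil_mul_card_le (le_of_lt (lt_of_lt_of_le hpp (min_le_right _ _))) L
  have h1 := hL₀ L hL
  have h2 := hceil L _ hk
  rw [plantedEff_eq_linEff_sub_gapEff hA] at h1
  linarith

/-! ### The vacuous payer: item 0636 -/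

/-- Item 0636 `IsingEuclidUpgradeR4NonGaussian` (every non-degenerate pointwise scaling limit of
`criticalCorr 3` has `U₄ ≢ 0` off coincidences) contradicts the hypotheses of stub C, hence proves it
(ex falso). -/
theorem gaussianLinearisesRegression_of_R4NonGaussian (h : IsingEuclidUpgradeR4NonGaussian) :
    GaussianLinearisesRegression := by
  intro ρ Δ S hρ _hΔ hlim hnd _hmob hU4
  exact absurd (h ρ S hρ hlim hnd) hU4

/-- Item 0636 `IsingEuclidUpgradeR4NonGaussian` contradicts the hypotheses of the crux
`GaussianPinningSaturation`, hence proves it (ex falso): the crux's vacuous payer. -/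
theorem gaussianPinningSaturation_of_R4NonGaussian (h : IsingEuclidUpgradeR4NonGaussian) :
    GaussianPinningSaturation := by
  rw [gaussianPinningSaturation_iff]
  intro ρ Δ S hρ _hΔ hlim hnd _hmob hU4
  exact absurd (h ρ S hρ hlim hnd) hU4

/-- Registered bookkeeping stub `stub_cruxOfR4NonGaussian` (lead seat c1): the vacuity wiring
crux ⇐ item 0636, keyed by its registered name (= `gaussianPinningSaturation_of_R4NonGaussian`). -/
theorem stub_cruxOfR4NonGaussian :
    Summit.CriticalPhenomena.Ising3DConformalLimit.Theses.IsingEuclidUpgrade.IsingEuclidUpgradeR4NonGaussian →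
      GaussianPinningSaturation :=
  gaussianPinningSaturation_of_R4NonGaussian

end Summit.CriticalPhenomena.Ising3DConformalLimit.PlantedPinningGaussianPinningSaturation

end
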